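import Mathlib.NumberTheory.NumberField.InfinitePlace.TotallyRealComplex
import Literature.NumberTheory.QuadraticForms.HilbertSymbolArchimedean
import Literature.NumberTheory.QuadraticForms.HilbertSymbolRatSigns
import HarnessLib

/-!
# The Hilbert symbol of rational numbers at the infinite place

Topic `NumberTheory/QuadraticForms`; namespace `Literature`; all declarations fully proved. The field
`ℚ` has a unique infinite place `w` (Mathlib `Rat.infinitePlace`, `Unique (InfinitePlace ℚ)`; it is real,
Mathlib `IsTotallyReal ℚ`), whose real embedding is the inclusion `ℚ ⊆ ℝ` (Mathlib `eq_ratCast`). By `HilbertSymbolArchimedean`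
(`hilbertSymbol_completion_eq_neg_one_iff_of_isReal`) the symbol `(a, b)_w` computed in the
completion `ℚ_w ≃ ℝ` is `-1` iff `a, b < 0`, i.e. it equals Serre's sign at infinity
`localSignInfty a b` (*A Course in Arithmetic*, Ch. III §1.2 Thm. 1, `k = ℝ`), and the set of
infinite places of `ℚ` with `(a, b)_w = -1` has `0` or `1` elements accordingly
(`ncard_setOf_hilbertSymbol_infinitePlace_rat`). This is the archimedean input (step G4) of the
proof of Hilbert reciprocity over `ℚ` from the product formula for the explicit signs
(`HilbertSymbolRatSigns.totalSign_eq_one`).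

## References

* J.-P. Serre, *A Course in Arithmetic*, GTM 7, Springer (1973), Ch. III §1.2 Thm. 1, §2.1 Thm. 3.
-/

noncomputable section

open NumberField

namespace Literature.NumberTheory.QuadraticForms

/-- **The symbol at the infinite place of `ℚ`**: for `a b ∈ ℚ` and an infinite place `w` of `ℚ`,
`(a, b)_w = -1` (in `ℚ_w ≃ ℝ`) iff `a ≤ 0` and `b ≤ 0` (so iff `a, b < 0` when `a b ≠ 0`;
Serre III Thm. 1 for `k = ℝ`). [cite: Serre1973, Ch. III §1.2 Thm. 1] -/
theorem hilbertSymbol_infinitePlace_rat_eq_neg_one_iff (w : InfinitePlace ℚ) (a b : ℚ) :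
    hilbertSymbol w.Completion (algebraMap ℚ _ a) (algebraMap ℚ _ b) = -1 ↔ a ≤ 0 ∧ b ≤ 0 := by
  rw [hilbertSymbol_completion_eq_neg_one_iff_of_isReal (IsTotallyReal.isReal w), eq_ratCast,
    eq_ratCast]
  exact_mod_cast Iff.rfl

/-- For non-zero integers `a b`, the symbol of `a, b` at an infinite place of `ℚ` is Serre's
explicit sign `localSignInfty a b` (`= -1` iff `a, b < 0`). [cite: Serre1973, Ch. III §1.2 Thm. 1] -/
theorem hilbertSymbol_infinitePlace_rat_eq_localSignInfty (w : InfinitePlace ℚ) {a b : ℤ}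
    (ha : a ≠ 0) (hb : b ≠ 0) :
    hilbertSymbol w.Completion (algebraMap ℚ _ (a : ℚ)) (algebraMap ℚ _ (b : ℚ)) =
      localSignInfty a b := by
  unfold localSignInfty
  by_cases h : a < 0 ∧ b < 0
  · rw [if_pos h, hilbertSymbol_infinitePlace_rat_eq_neg_one_iff]
    exact ⟨by exact_mod_cast h.1.le, by exact_mod_cast h.2.le⟩
  · rw [if_neg h, ← hilbertSymbol_ne_neg_one_iff, Ne, hilbertSymbol_infinitePlace_rat_eq_neg_one_iff]
    rintro ⟨h1, h2⟩
    have h1' : (a : ℚ) < 0 := lt_of_le_of_ne h1 (by exact_mod_cast ha)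
    have h2' : (b : ℚ) < 0 := lt_of_le_of_ne h2 (by exact_mod_cast hb)
    exact h ⟨by exact_mod_cast h1', by exact_mod_cast h2'⟩

/-- The set of infinite places of `ℚ` at which `(a, b)_w = -1` (`a b` non-zero integers) is all of
`InfinitePlace ℚ` (one element) if `a, b < 0` and empty otherwise; its cardinality is accordingly
`1` or `0`. [folklore] -/
theorem ncard_setOf_hilbertSymbol_infinitePlace_rat {a b : ℤ} (ha : a ≠ 0) (hb : b ≠ 0) :
    {w : InfinitePlace ℚ |
        hilbertSymbol w.Completion (algebraMap ℚ _ (a : ℚ)) (algebraMap ℚ _ (b : ℚ)) = -1}.ncard =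
      if localSignInfty a b = -1 then 1 else 0 := by
  have hset : {w : InfinitePlace ℚ |
      hilbertSymbol w.Completion (algebraMap ℚ _ (a : ℚ)) (algebraMap ℚ _ (b : ℚ)) = -1} =
      if localSignInfty a b = -1 then Set.univ else ∅ := by
    ext w
    simp only [Set.mem_setOf_eq, hilbertSymbol_infinitePlace_rat_eq_localSignInfty w ha hb]
    split_ifs with h <;> simp [h]
  rw [hset]
  split_ifs
  · rw [Set.ncard_univ, Nat.card_unique]
  · exact Set.ncard_empty _

end Literature.NumberTheory.QuadraticForms
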